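import Summits.AtomisticToContinuum.Crystallization.Theses.SpectralChargeLedger
import Summits.AtomisticToContinuum.Crystallization.Theorems.ThreeConeCertificateSlackRigidityHcpAdmissible
import Summits.AtomisticToContinuum.Crystallization.Theorems.ChargedEnergyGap.Negative.BlocksBound

/-!
# Crux `SummedShellPricing` (stmt-AtomisticToContinuum-17044, K1 of route `SpectralChargeLedger`),
# line `Sketch`: registered sub-goal G2 `stub_floorCellWindow` — the floor's cell is in K1's window

If `N·e(hcp(a,h)) ≤ E_LJ(x)` for every finite injective configuration `x` (the floor of
`HcpBulkFloor`, with `(a,h)` in the wide box `a ∈ [47/50, 1]`, `h ∈ [39a/50, 17a/20]`), then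
`|h − a√(2/3)| ≤ a/100`.

Proof.
* FLOOR ⇒ GLOBAL PERIODIC MINIMALITY (`energyPerParticle_le_of_floor`): for every periodic `Q`,
  apply the floor to the large blocks `Blocks.blockConfig Q K` of `Q` (injective,
  `Blocks.blockConfig_injective`; `#block = #motif·K³ > 0`, `Blocks.card_BIdx`), whose energy is
  `≤ #block·(e(Q) + ε)` for `K ≥ K₀(ε)` (`Blocks.exists_block_energy_le`); divide by `#block` and let
  `ε → 0` (`le_of_forall_pos_le_add`).
* Hence `(a,h)` minimises `e(hcp(·,·))` over `[1/2,2]²` (and lies in it), so the certified window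
  `SlackRigidityHcpAdmissible.lms_hcpBoxMinimiser_window` (p158430) gives
  `h/a ∈ (8148/10000, 8250/10000)`.
* NUMERICS: `√(2/3) ∈ (815/1000, 8248/10000)` (squares compared by `norm_num`), so
  `a(√(2/3) − 1/100) < 8148a/10000 < h < 8250a/10000 < a(√(2/3) + 1/100)`.
All `[folklore]`; no new definitions.
-/

noncomputable section

namespace Summit.AtomisticToContinuum.Crystallization.Theorems.SummedShellPricingFloorCell

open scoped BigOperators Classical
open Literature.MathematicalPhysics.StatisticalMechanics Literature.Geometry.DiscreteGeometry
open Summit.AtomisticToContinuum.Crystallization.Theorems.ChargedEnergyGapNegative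
open Summit.AtomisticToContinuum.Crystallization.Theorems.SlackRigidityHcpAdmissible
  (lms_hcpBoxMinimiser_window)

/-- **Floor ⇒ global periodic minimality.**  If `N·e ≤ E_LJ(x)` for every finite injective
configuration `x : Fin N → ℝ³`, then `e ≤ e(Q)` for every periodic configuration `Q` of `ℝ³`
(trial blocks of `Q`, `Blocks.exists_block_energy_le`). [folklore] -/
theorem energyPerParticle_le_of_floor {e : ℝ}
    (hfloor : ∀ (N : ℕ) (x : Fin N → EuclideanSpace ℝ (Fin 3)), Function.Injective x →
      (N : ℝ) * e ≤ interactionEnergy lennardJones x)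
    (Q : PeriodicConfiguration 3) : e ≤ Q.energyPerParticle lennardJones := by
  -- adapted from Theorems/ChargedEnergyGap/Negative/BlocksBound.lean (`limsup_div_le_energyPerParticle`)
  refine le_of_forall_pos_le_add fun ε hε => ?_
  obtain ⟨K₀, hK₀, hK⟩ := Blocks.exists_block_energy_le Q hε
  have hnpos : 0 < Fintype.card (Blocks.BIdx Q K₀) := by
    rw [Blocks.card_BIdx]; exact Nat.mul_pos Q.motif_nonempty.card_pos (pow_pos hK₀ 3)
  have hn : (0 : ℝ) < Fintype.card (Blocks.BIdx Q K₀) := by exact_mod_cast hnpos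
  have h1 := hfloor _ (Blocks.blockConfig Q K₀) (Blocks.blockConfig_injective Q K₀)
  have h2 := hK K₀ le_rfl
  have h3 : (Fintype.card (Blocks.BIdx Q K₀) : ℝ) * e ≤
      (Fintype.card (Blocks.BIdx Q K₀) : ℝ) * (Q.energyPerParticle lennardJones + ε) :=
    h1.trans h2
  exact le_of_mul_le_mul_left h3 hn

/-- **Numerics of the window**: `8148/10000 < h/a < 8250/10000` and `0 < a` give
`|h − a√(2/3)| ≤ a/100`, since `√(2/3) ∈ (815/1000, 8248/10000)`. [folklore] -/
theorem abs_sub_sqrt_le_of_window {a h : ℝ} (ha0 : 0 < a)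
    (hw1 : 8148 / 10000 < h / a) (hw2 : h / a < 8250 / 10000) :
    |h - a * Real.sqrt (2 / 3)| ≤ a / 100 := by
  have hlo : (815 : ℝ) / 1000 < Real.sqrt (2 / 3) :=
    (Real.lt_sqrt (by norm_num)).2 (by norm_num)
  have hhi : Real.sqrt (2 / 3) < (8248 : ℝ) / 10000 :=
    (Real.sqrt_lt' (by norm_num)).2 (by norm_num)
  have h1 : (8148 : ℝ) / 10000 * a < h := by
    have := hw1; rw [lt_div_iff₀ ha0] at this; linarith
  have h2 : h < (8250 : ℝ) / 10000 * a := by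
    have := hw2; rw [div_lt_iff₀ ha0] at this; linarith
  have h3 : a * ((815 : ℝ) / 1000) < a * Real.sqrt (2 / 3) := mul_lt_mul_of_pos_left hlo ha0
  have h4 : a * Real.sqrt (2 / 3) < a * ((8248 : ℝ) / 10000) := mul_lt_mul_of_pos_left hhi ha0
  rw [abs_le]
  constructor <;> linarith

/-- **Sub-goal G2 — the floor's cell is in K1's window.**  If `N·e(hcp(a,h)) ≤ E_LJ(x)` for every
finite injective `x` (the floor of `HcpBulkFloor`, `(a,h)` in the wide box `a ∈ [47/50,1]`,
`h ∈ [39a/50, 17a/20]`), then `|h − a√(2/3)| ≤ a/100`: the floor applied to large blocks of any periodic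
`Q` gives `e(hcp(a,h)) ≤ e(Q)` (`energyPerParticle_le_of_floor`), so `(a,h)` minimises `e(hcp(·,·))`
over `[1/2,2]²` and the certified window `lms_hcpBoxMinimiser_window` (p158430) gives
`h/a ∈ (8148/10000, 8250/10000) ⊂ [√(2/3) − 1/100, √(2/3) + 1/100]`. [folklore] -/
theorem stub_floorCellWindow :
    ∀ (a h : ℝ) (ha : a ≠ 0) (hh : h ≠ 0), 47 / 50 ≤ a → a ≤ 1 → 39 / 50 * a ≤ h → h ≤ 17 / 20 * a →
    (∀ (N : ℕ) (x : Fin N → EuclideanSpace ℝ (Fin 3)), Function.Injective x →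
      (N : ℝ) * (hcpPeriodicConfiguration ha hh).energyPerParticle lennardJones ≤
        interactionEnergy lennardJones x) →
    |h - a * Real.sqrt (2 / 3)| ≤ a / 100 := by
  intro a h ha hh ha1 ha2 hh1 hh2 hfloor
  have ha0 : 0 < a := by linarith
  have hmin : ∀ (b k : ℝ) (hb : b ≠ 0) (hk : k ≠ 0), 1 / 2 ≤ b → b ≤ 2 → 1 / 2 ≤ k → k ≤ 2 →
      (hcpPeriodicConfiguration ha hh).energyPerParticle lennardJones ≤
        (hcpPeriodicConfiguration hb hk).energyPerParticle lennardJones :=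
    fun b k hb hk _ _ _ _ => energyPerParticle_le_of_floor hfloor (hcpPeriodicConfiguration hb hk)
  obtain ⟨hw1, hw2, -, -⟩ := lms_hcpBoxMinimiser_window a h ha hh (by linarith) (by linarith)
    (by nlinarith) (by nlinarith) hmin
  exact abs_sub_sqrt_le_of_window ha0 hw1 hw2

end Summit.AtomisticToContinuum.Crystallization.Theorems.SummedShellPricingFloorCell

end
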